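import Summits.Ventures.PercRepro.SixFourResidueFourGenericA

/-!
# PercRepro — C-025 at `(6,4)`: Theorem G for EVERY `g`, modulo the per-pair inequality at `t = 4` (p3, gen 11 — §21.13)

The `t = 4` generic case without any plane cap (mine-2's Theorem G, §21.13), second half — the twin of p2's
`SixFourResidueThreeGenericAll.lean`.  On a rank-`3` plane trace `ρ` with `p` points the certificate is ADDITIVE
over the lines of `ρ` (2-point lines included): `Σ_λ y_{m_λ}(p − m_λ) − cost_g(ρ) − (2/3)·Σ_λ ε(m_λ)C(p − m_λ, 2) =
Σ_λ L(g,p,m_λ) − base(g,p)`, and since `Σ_λ C(m_λ, 2) = C(p,2)` it is `≥ (6/5)·Ξ_g(p − 1)` as soon as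
`PerPair4 g p m` holds for every line size `2 ≤ m ≤ p − 1` (`cert_plane_of_perPair4`).  Summing over the planes with
§22.3 (`sum_inc_mul_eq`, for every `m`), §22.2 (`lpp_ge`, `sum_eps_choose_le`) and the partner bound
`Xcnt_le_sum_xiCrude` inside `J_four_identity` gives

  `J_four_nonneg_of_generic_of_perPair : Generic M G → (∀ p m, 3 ≤ p → p + 3 ≤ g → 2 ≤ m → m < p → PerPair4 g p m) → 0 ≤ J₄(G)`.

mine-2's §21.13.3: `PerPair4 g p m` (their `T(g,p) > 0`) holds for every `10 ≤ g ≤ 100` (exact table, minimum ratio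
`0.0508` at `(g, p) = (11, 8)`) and for `g ≥ 101` (two regimes in `c = g − p`).  Those are the remaining obligations of
Theorem G (`GenericFour`); this file reduces the generic case to them.
-/

namespace PercRepro.SixFour

open Finset ThmH

variable {α : Type*} [DecidableEq α] {M : Matroid α} [M.Finite] {G : Finset α}

/-- **The additive certificate on a rank-`3` plane trace**: if the per-pair inequality holds for every line size
`2 ≤ m < p`, then `cost_g(P) + (6/5)·Ξ_g(p − 1) + (2/3)·lppCredit(P) ≤ Σ_λ y_{m_λ}(p − m_λ)`. -/
theorem cert_plane_of_perPair4 (hs : Simple M) (hG : G ⊆ gr M) {P : Finset α}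
    (hr : M.eRk ((P ∩ G : Finset α) : Set α) = 3)
    (hpp : ∀ m, 2 ≤ m → m < (P ∩ G).card → PerPair4 G.card (P ∩ G).card m) :
    cost M G P + 6 / 5 * (xiCrude G.card (P ∩ G).card : ℚ) + 2 / 3 * (lppCredit M G P : ℚ) ≤
      certRHS4 M G P G.card := by
  set ρ := P ∩ G with hρdef
  have hρ : ρ ⊆ gr M := Finset.inter_subset_right.trans hG
  have hp3 : 3 ≤ ρ.card := three_le_card_of_eRk_eq_three hr
  -- the line sizes are `< p` (a line containing the whole trace would have rank `2`)
  have hlt : ∀ L ∈ lines M, (L ∩ ρ).card < ρ.card := by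
    intro L hL
    have hle : (L ∩ ρ).card ≤ ρ.card := Finset.card_le_card Finset.inter_subset_right
    rcases Nat.lt_or_ge (L ∩ ρ).card ρ.card with h | h
    · exact h
    · exfalso
      have heq : L ∩ ρ = ρ := Finset.eq_of_subset_of_card_le Finset.inter_subset_right h
      have hsub : ρ ⊆ L := by rw [← heq]; exact Finset.inter_subset_left
      have h2 := M.eRk_mono (Finset.coe_subset.2 hsub)
      rw [hr, (mem_lines.1 hL).2.2] at h2
      have h32 : (3 : ℕ) ≤ 2 := by exact_mod_cast h2
      omega
  -- per line: `C(p,2)·L(m_λ) ≥ C(m_λ,2)·[base + (6/5)Ξ]`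
  have hterm : ∀ L ∈ lines M,
      ((L ∩ ρ).card.choose 2 : ℚ) * (base4 G.card ρ.card + 6 / 5 * (xiCrude G.card ρ.card : ℚ)) ≤
        (ρ.card.choose 2 : ℚ) * Lterm4 G.card ρ.card (L ∩ ρ).card := by
    intro L hL
    rcases Nat.lt_or_ge (L ∩ ρ).card 2 with h | h
    · exact perPair4_of_le_one _ _ (by omega)
    · exact hpp _ h (hlt L hL)
  have hsum := Finset.sum_le_sum hterm
  -- `Σ_λ C(m_λ,2) = C(p,2)`
  have hpairs : ∑ L ∈ lines M, ((L ∩ ρ).card.choose 2 : ℚ) = (ρ.card.choose 2 : ℚ) := by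
    exact_mod_cast sum_choose_two_trace hs hρ
  rw [← Finset.sum_mul, hpairs, ← Finset.mul_sum] at hsum
  have hC : (0 : ℚ) < (ρ.card.choose 2 : ℚ) := by
    have : 0 < ρ.card.choose 2 := Nat.choose_pos (by omega)
    exact_mod_cast this
  have hsum' : base4 G.card ρ.card + 6 / 5 * (xiCrude G.card ρ.card : ℚ) ≤
      ∑ L ∈ lines M, Lterm4 G.card ρ.card (L ∩ ρ).card :=
    le_of_mul_le_mul_left hsum hC
  -- the identities for `D₃`, `r₃₄`, `lppCredit` in line-sum form
  have hD : (D3 M G P : ℚ) = (delta ρ.card : ℚ) - ∑ L ∈ lines M, (delta (L ∩ ρ).card : ℚ) := by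
    have h := D3_add_sum_delta hs hρ hr
    have h' : (D3 M G P : ℚ) + ∑ L ∈ lines M, (delta (L ∩ ρ).card : ℚ) = (delta ρ.card : ℚ) := by
      unfold D3
      exact_mod_cast h
    linarith
  have hR : (r34 M G P : ℚ) = (ρ.card.choose 4 : ℚ) - ∑ L ∈ lines M, ((L ∩ ρ).card.choose 4 : ℚ) := by
    have h := r34_add_sum_choose_four_lines hs hG hr
    have h' : (r34 M G P : ℚ) + ∑ L ∈ lines M, ((L ∩ ρ).card.choose 4 : ℚ) = (ρ.card.choose 4 : ℚ) := by
      exact_mod_cast h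
    linarith
  have hL : (lppCredit M G P : ℚ) =
      ∑ L ∈ lines M, ((eps (L ∩ ρ).card : ℚ) * ((ρ.card - (L ∩ ρ).card).choose 2 : ℚ)) := by
    unfold lppCredit
    push_cast
    rfl
  -- assemble: `certRHS4 − cost − (2/3)·lppCredit = Σ_λ L(m_λ) − base`
  have hsplit : ∑ L ∈ lines M, Lterm4 G.card ρ.card (L ∩ ρ).card =
      ∑ L ∈ lines M, yPrice4 G.card (L ∩ ρ).card * ((ρ.card - (L ∩ ρ).card : ℕ) : ℚ) +
        ((G.card : ℚ) - ρ.card - 2 / 5) * ∑ L ∈ lines M, (delta (L ∩ ρ).card : ℚ) -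
        8 / 5 * ∑ L ∈ lines M, ((L ∩ ρ).card.choose 4 : ℚ) -
        2 / 3 * ∑ L ∈ lines M, ((eps (L ∩ ρ).card : ℚ) * ((ρ.card - (L ∩ ρ).card).choose 2 : ℚ)) := by
    simp only [Lterm4, Finset.sum_add_distrib, Finset.sum_sub_distrib, Finset.mul_sum]
  have hexp : certRHS4 M G P G.card - cost M G P - 2 / 3 * (lppCredit M G P : ℚ) =
      ∑ L ∈ lines M, Lterm4 G.card ρ.card (L ∩ ρ).card - base4 G.card ρ.card := by
    unfold certRHS4 cost base4
    rw [← hρdef, hsplit, hD, hR, hL]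
    ring
  linarith

/-- The right side vanishes on a plane whose trace has rank `≠ 3`: a line meeting the trace in `≥ 2` points contains
it (so the factor `p − m_λ` is `0`), and `y_0 = y_1 = 0`. -/
theorem certRHS4_eq_zero_of_ne (hs : Simple M) (hG : G ⊆ gr M) {P : Finset α} (hP : P ∈ planes M)
    (hne : ¬ M.eRk ((P ∩ G : Finset α) : Set α) = 3) : certRHS4 M G P G.card = 0 := by
  set ρ := P ∩ G with hρdef
  have hρ : ρ ⊆ gr M := Finset.inter_subset_right.trans hG
  have hle2 : M.eRk (ρ : Set α) ≤ 2 := by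
    have hle3 : M.eRk (ρ : Set α) ≤ 3 := by
      rw [← (mem_planes.1 hP).2.2]
      exact M.eRk_mono (Finset.coe_subset.2 Finset.inter_subset_left)
    obtain ⟨n, hn, -⟩ := eRk_eq_nat M ρ
    rw [hn] at hle3 hne ⊢
    have a1 : n ≤ 3 := by exact_mod_cast hle3
    have a3 : n ≠ 3 := fun h => hne (by rw [h]; rfl)
    exact_mod_cast (show n ≤ 2 by omega)
  unfold certRHS4
  refine Finset.sum_eq_zero (fun L hL => ?_)
  rcases Nat.lt_or_ge (L ∩ ρ).card 2 with h | h
  · interval_cases hm : (L ∩ ρ).card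
    · rw [yPrice4_zero, zero_mul]
    · rw [yPrice4_one, zero_mul]
  · -- two points of `ρ` on `L`: `ρ ⊆ cl(two points) = L`
    obtain ⟨a, ha, b, hb, hab⟩ := Finset.one_lt_card.1 (by omega : 1 < (L ∩ ρ).card)
    rw [Finset.mem_inter] at ha hb
    have hsub2 : ({a, b} : Finset α) ⊆ L := by
      intro z hz
      rw [Finset.mem_insert, Finset.mem_singleton] at hz
      rcases hz with rfl | rfl
      · exact ha.1
      · exact hb.1
    have hr2 : M.eRk (({a, b} : Finset α) : Set α) = 2 :=
      eRk_eq_two_of_subset_line hs hL hsub2 (by rw [Finset.card_pair hab])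
    have hρL : ρ ⊆ L := by
      have hsubρ : ({a, b} : Finset α) ⊆ ρ := by
        intro w hw
        rw [Finset.mem_insert, Finset.mem_singleton] at hw
        rcases hw with rfl | rfl
        · exact ha.2
        · exact hb.2
      have hρ2 : M.eRk (ρ : Set α) = 2 :=
        le_antisymm hle2 (by rw [← hr2]; exact M.eRk_mono (Finset.coe_subset.2 hsubρ))
      obtain ⟨hL', hρcl⟩ := clF_mem_lines hρ hρ2
      have heqL : L = clF M ρ :=
        lines_eq_of_two_mem hs hL hL' ha.1 hb.1 (hρcl ha.2) (hρcl hb.2) hab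
      rw [heqL]
      exact hρcl
    have heq : L ∩ ρ = ρ := Finset.inter_eq_right.2 hρL
    rw [heq, Nat.sub_self, Nat.cast_zero, mul_zero]

/-- `Σ_{P ∈ planes} Σ_λ y_{m_λ}(p_P − m_λ) = Σ_{m ≤ g} y_m·(g − m)·b_m` (§22.3 for every line size). -/
theorem sum_certRHS4_eq (hs : Simple M) (hG : G ⊆ gr M) :
    ∑ P ∈ planes M, certRHS4 M G P G.card =
      ∑ m ∈ Finset.range (G.card + 1), yPrice4 G.card m * ((G.card - m : ℕ) : ℚ) * (bLines M G m : ℚ) := by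
  unfold certRHS4
  have hplane : ∀ P ∈ planes M,
      ∑ L ∈ lines M, yPrice4 G.card (L ∩ (P ∩ G)).card * (((P ∩ G).card - (L ∩ (P ∩ G)).card : ℕ) : ℚ) =
        ∑ m ∈ Finset.range (G.card + 1), (inc M (P ∩ G) m : ℚ) * (yPrice4 G.card m * (((P ∩ G).card - m : ℕ) : ℚ)) := by
    intro P _
    rw [sum_lines_eq_sum_inc_rat (P ∩ G) (fun m => yPrice4 G.card m * (((P ∩ G).card - m : ℕ) : ℚ))]
    apply Finset.sum_subset
    · intro m hm
      rw [Finset.mem_range] at hm ⊢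
      have := Finset.card_le_card (Finset.inter_subset_right (s₁ := P) (s₂ := G))
      omega
    · intro m hm hm'
      rw [Finset.mem_range] at hm hm'
      rw [inc_eq_zero_of_lt_card (P ∩ G) (by omega), Nat.cast_zero, zero_mul]
  rw [Finset.sum_congr rfl hplane, Finset.sum_comm]
  refine Finset.sum_congr rfl (fun m hm => ?_)
  rw [Finset.mem_range] at hm
  rcases Nat.lt_or_ge m 2 with h2 | h2
  · interval_cases m
    · simp [yPrice4_zero]
    · simp [yPrice4_one]
  · have h := sum_inc_mul_eq hs hG (m := m) h2
    have h' : ∑ P ∈ planes M, ((inc M (P ∩ G) m * ((P ∩ G).card - m) : ℕ) : ℚ) =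
        ((G.card - m : ℕ) : ℚ) * (bLines M G m : ℚ) := by
      rw [← Nat.cast_sum, h, Nat.cast_mul]
    rw [mul_assoc, ← h', Finset.mul_sum]
    refine Finset.sum_congr rfl (fun P _ => ?_)
    push_cast
    ring

/-- `b_g = 0`: no line contains the whole rank-`4` set `G`. -/
theorem bLines_self_eq_zero (hr : M.eRk (G : Set α) = 4) : bLines M G G.card = 0 := by
  unfold bLines inc
  rw [Finset.card_eq_zero, Finset.filter_eq_empty_iff]
  intro L hL hc
  have heq : L ∩ G = G := Finset.eq_of_subset_of_card_le Finset.inter_subset_right (by omega)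
  have hsub : G ⊆ L := by rw [← heq]; exact Finset.inter_subset_left
  have h := M.eRk_mono (Finset.coe_subset.2 hsub)
  rw [hr, (mem_lines.1 hL).2.2] at h
  have h42 : (4 : ℕ) ≤ 2 := by exact_mod_cast h
  omega

/-! ## Theorem G modulo the per-pair inequality -/

/-- **Theorem G modulo the per-pair inequality** (§21.13.4): for a generic rank-`4` set `G ⊆ E` of a simple matroid
with `g ≥ 7` points, `0 ≤ J₄(G)` as soon as `PerPair4 g p m` holds for `3 ≤ p ≤ g − 3`, `2 ≤ m < p`. -/
theorem J_four_nonneg_of_generic_of_perPair (hs : Simple M) (hG : G ⊆ gr M) (hr : M.eRk (G : Set α) = 4)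
    (hgen : Generic M G) (hg : 7 ≤ G.card)
    (hpp : ∀ p m, 3 ≤ p → p + 3 ≤ G.card → 2 ≤ m → m < p → PerPair4 G.card p m) : 0 ≤ J M G 4 := by
  set S := (planes M).filter (fun P : Finset α => M.eRk ((P ∩ G : Finset α) : Set α) = 3) with hS
  -- F1: the identity
  have F1 := J_four_identity hs hG hr
  -- F2: the cost sum restricted to the rank-`3` planes
  have F2 := sum_cost_le (M := M) G
  -- F3: the additive certificate summed over `S`
  have F3 : ∑ P ∈ S, cost M G P + 6 / 5 * ∑ P ∈ S, (xiCrude G.card (P ∩ G).card : ℚ) +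
      2 / 3 * ∑ P ∈ S, (lppCredit M G P : ℚ) ≤ ∑ P ∈ S, certRHS4 M G P G.card := by
    rw [Finset.mul_sum, Finset.mul_sum, ← Finset.sum_add_distrib, ← Finset.sum_add_distrib]
    refine Finset.sum_le_sum (fun P hP => ?_)
    obtain ⟨hP, hr3⟩ := Finset.mem_filter.1 hP
    refine cert_plane_of_perPair4 hs hG hr3 (fun m hm2 hmp => ?_)
    have hp3 := three_le_card_of_eRk_eq_three hr3
    exact hpp _ _ hp3 (card_trace_add_three_le_of_generic hgen hP) hm2 hmp
  -- F4: the right side over `S` is the right side over all planes (it vanishes elsewhere)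
  have F4 : ∑ P ∈ S, certRHS4 M G P G.card = ∑ P ∈ planes M, certRHS4 M G P G.card := by
    rw [hS]
    apply Finset.sum_subset (Finset.filter_subset _ _)
    intro P hP hPS
    rw [Finset.mem_filter, not_and] at hPS
    exact certRHS4_eq_zero_of_ne hs hG hP (hPS hP)
  -- F5 + F6: the right side as the line quantities, with the price identities
  have F56 : ∑ P ∈ planes M, certRHS4 M G P G.card =
      yP4 G.card * ∑ L ∈ lines M, ((L ∩ G).card.choose 2 : ℚ) + ∑ L ∈ lines M, bonus (L ∩ G).card +
        2 / 3 * ∑ L ∈ lines M, ((eps (L ∩ G).card : ℚ) * ((G.card - (L ∩ G).card).choose 2 : ℚ)) := by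
    rw [sum_certRHS4_eq hs hG]
    rw [sum_lines_eq_sum_inc_rat G (fun m => (m.choose 2 : ℚ)), sum_lines_eq_sum_inc_rat G (fun m => bonus m),
      sum_lines_eq_sum_inc_rat G (fun m => (eps m : ℚ) * ((G.card - m).choose 2 : ℚ))]
    rw [Finset.mul_sum, Finset.mul_sum, ← Finset.sum_add_distrib, ← Finset.sum_add_distrib]
    refine Finset.sum_congr rfl (fun m hm => ?_)
    rw [Finset.mem_range] at hm
    rcases Nat.lt_or_ge m G.card with hlt | hge
    · rw [price_identity4 hlt]
      unfold bLines
      ring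
    · have hm' : m = G.card := by omega
      subst hm'
      rw [show bLines M G G.card = inc M G G.card from rfl, ← show bLines M G G.card = inc M G G.card from rfl,
        bLines_self_eq_zero hr]
      simp
  -- F7: `Σ_λ C(m_λ,2) = C(g,2)`
  have F7 : ∑ L ∈ lines M, ((L ∩ G).card.choose 2 : ℚ) = (G.card.choose 2 : ℚ) := by
    exact_mod_cast sum_choose_two_trace hs hG
  -- F8: the partner bound
  have F8 : (Xcnt M G : ℚ) ≤ ∑ P ∈ S, (xiCrude G.card (P ∩ G).card : ℚ) := by
    have := Xcnt_le_sum_xiCrude hG hr hgen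
    rw [← hS] at this
    exact_mod_cast this
  -- F9: the `lpp` lower bound
  have F9 : ∑ L ∈ lines M, ((eps (L ∩ G).card : ℚ) * ((crossPairs M G L).card : ℚ)) ≤ (lpp M G : ℚ) := by
    have := lpp_ge hs hG
    have h' : ∑ L ∈ lines M, ((eps (L ∩ G).card : ℚ) * ((crossPairs M G L).card : ℚ)) =
        ((∑ L ∈ lines M, eps (L ∩ G).card * (crossPairs M G L).card : ℕ) : ℚ) := by push_cast; rfl
    rw [h']
    exact_mod_cast this
  -- F10: the lpp credit
  have F10 : ∑ L ∈ lines M, ((eps (L ∩ G).card : ℚ) * ((G.card - (L ∩ G).card).choose 2 : ℚ)) ≤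
      ∑ L ∈ lines M, ((eps (L ∩ G).card : ℚ) * ((crossPairs M G L).card : ℚ)) + ∑ P ∈ S, (lppCredit M G P : ℚ) := by
    have := sum_eps_choose_le hs hG
    rw [← hS] at this
    have h1 : ∑ L ∈ lines M, ((eps (L ∩ G).card : ℚ) * ((G.card - (L ∩ G).card).choose 2 : ℚ)) =
        ((∑ L ∈ lines M, eps (L ∩ G).card * (G.card - (L ∩ G).card).choose 2 : ℕ) : ℚ) := by push_cast; rfl
    have h2 : ∑ L ∈ lines M, ((eps (L ∩ G).card : ℚ) * ((crossPairs M G L).card : ℚ)) =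
        ((∑ L ∈ lines M, eps (L ∩ G).card * (crossPairs M G L).card : ℕ) : ℚ) := by push_cast; rfl
    have h3 : ∑ P ∈ S, (lppCredit M G P : ℚ) = ((∑ P ∈ S, lppCredit M G P : ℕ) : ℚ) := by push_cast; rfl
    rw [h1, h2, h3, ← Nat.cast_add]
    exact_mod_cast this
  -- F11: `F(g) = y_P·C(g,2)`
  have F11 := Fg_eq_yP4 (g := G.card) (by omega)
  rw [F1]
  rw [F7] at F56
  linarith [F2, F3, F4, F56, F8, F9, F10, F11]

end PercRepro.SixFour
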